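import Summits.BirchSwinnertonDyer.BirchSwinnertonDyer.Theorems.ManinLocalTwoThreeShimuraFiveFamilyRootNumber
import Literature.NumberTheory.EllipticCurves.KubertTateFiveMinimalModel
import HarnessLib

/-!
# The moduli row E-es-239 split into a geometric step (Vélu quotient) and a Kummer step (fifth powers);
# the sign law at `5` on `X₁(5)` (cell bsd-f2-manin, es g44 ROAD δ part 5; MEMO-es §67.3, §67.5)

Cell bsd-f2-manin, seat es (planner), gen 44.  Typed rows over tree declarations; every row is an `@[conjecture] def … : Prop`.
After `ShimuraFive.veluFiveFamilyRootNumberLaw_holds` (E-es-238, a THEOREM) the local law L5 (`SplitFiveTorsionRootNumberLaw`,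
E-es-235) hangs on the single moduli row E-es-239 `SplitFiveTorsionModuli` («a rational point of order `5` + `W[5]` fixed by
`Gal(ℚ̄/ℚ(μ₅))` ⟹ `C • W = veluFive (s⁵)`»).  This file splits E-es-239 into its two mathematically distinct halves:
* E-es-241 `SplitFiveTorsionIsVeluQuotient` — GEOMETRY: such a `W` is, over `ℚ`, a fibre `veluFive b` of the Vélu family
  (`W[5]` is a semisimple `Gal(ℚ(μ₅)/ℚ)`-module with the trivial line `⟨t⟩`, hence `W[5] ≅ ℤ/5 ⊕ μ₅` (Maschke, `4 ∤ 5`… `5 ∤ 4`);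
  the complement `C ≅ μ₅` is a rational subgroup scheme; `V := W/C` carries the rational `5`-point `t̄`, so `(V, t̄) ≅ (E_b, (0,0))`
  (Tate normal form, tree `exists_variableChange_eq_kubertTate_self_of_addOrderOf_eq_five'`), and `W ≅ V/⟨t̄⟩ = E_b/⟨(0,0)⟩ = veluFive b`
  by `[5] = ψ̂ ∘ ψ` and the uniqueness of quotients — tree `WeierstrassCurve.quotCurve`, `KubertTateVelu.fiveIsogeny`);
* E-es-242 `VeluFiveRationalFiveTorsion` — ARITHMETIC (Kummer theory on `X₁(5)`): `veluFive b` has a rational point of order `5`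
  only if `b ∈ ℚˣ⁵` (the dual isogeny `ψ : veluFive b → E_b` has kernel `≅ μ₅`, without rational points of order `5`; so `ψ(P) = jT`,
  `j ≢ 0`, and `jT ∈ ψ(E'(ℚ))` kills the Kummer class `δ(T) = b⁻¹ · ℚˣ⁵` of the tree's Kummer function `f_T = xy − x² + y`
  (`KubertTateKummer.kummerFn`, `(m,n) = (b,1)`): `b = s⁵`).
EDGE `splitFiveTorsionModuli_of : E-es-241 → E-es-242 → E-es-239` (transport of the rational `5`-point along the change of variables,
tree `VariableChange.pointEquiv`, `Affine.Point.congrEquiv`), and the composite edges to L5 (E-es-235) and to `ShimuraFiveNoTwentyFive`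
through the landed theorem `veluFiveFamilyRootNumberLaw_holds`.  Row E-es-240 `KubertTateFiveSignAtFiveLaw` is the companion SIGN LAW
AT `5` ON `X₁(5)` ITSELF (Tate normal form `E_{m,n}`, `(m,n) = 1`, additive at `5`: `w₅ = −1 ⟺ m ≡ 18n (mod 25)` — Kodaira III on the class
`m ≡ 18n (25)`, Kodaira II (`e = 6`, `w₅ = (−1/5) = +1`) on the other four classes `m ≡ 3n (5)`), which explains E-es-238: fifth powers
`u⁵ ≡ 3d⁵ (5)` automatically satisfy `u⁵ ≡ 18d⁵ (25)`; it is proved in `Theorems/ManinLocalTwoThreeKubertTateFiveSignAtFive`.  The converse of E-es-242 («`veluFive (s⁵)` has a rational point of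
order `5`») is true and cheap but not needed on road δ.
BSD is not proved here; C2/C3 untouched; E-es-224/227/235/239 remain OPEN (239 ⟸ 241 ∧ 242).
[cite: SilvermanAEC2009, III.4.12, VIII.2 (Kummer pairing), X.4.9] [cite: Knapp1993, V.5 (5.31)] [cite: Velu1971] [cite: Fisher2001FiveSevenDescent, §1]
-/

set_option autoImplicit false

noncomputable section

open WeierstrassCurve Literature.NumberTheory.EllipticCurves IsDedekindDomain
open Summit.BirchSwinnertonDyer.Rank1Residual.ManinAdditive
open Summit.BirchSwinnertonDyer.Rank1Residual.ManinAdditive.EsG43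

namespace Summit.BirchSwinnertonDyer.Rank1Residual.ManinAdditive.EsG44

/-- E-es-240 (THE SIGN LAW AT `5` ON `X₁(5)`).  For coprime integers `m, n` with the Tate normal form `E_{m,n} = kubertTateFive m n`
(`y² + (n − m)xy − mn²y = x³ − mnx²`, the point `(0,0)` of order `5`) elliptic and ADDITIVE at `5`, Rohrlich's local root number is
`w₅ = −1` exactly on the class `m ≡ 18n (mod 25)` (Kodaira III, `ord₅Δ = 3`, `e = 4`, `(−2/5) = −1`) and `w₅ = +1` on the other additive classes
(`m ≡ 3n (mod 5)`, `m ≢ 18n (mod 25)`: Kodaira II, `ord₅Δ = 2`, `e = 6`, `(−1/5) = +1`).  Why it might fail: a slip in the residue analysis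
`Q(3n + 5k, n) = 25(k² − kn − n²)`, `ord₅ ∈ {2, 3}` (tree `quadForm₅_three_mul_add`, `not_five_pow_four_dvd_quadForm₅`); falsifier: PARI `ellrootno(E_{m,n}, 5)`
over coprime `|m|, |n| ≤ 200`.  [cite: Rohrlich1993Compositio, Prop. 2 (iv)] [cite: Serre1972, §5.6] [cite: SilvermanAEC2009, VII.1 Remark 1.1]
[cite: Kubert1976, Table 3 (N = 5)] -/
@[conjecture] def KubertTateFiveSignAtFiveLaw : Prop :=
  ∀ (m n : ℤ) [((kubertTateFive m n).baseChange ℚ).IsElliptic], IsCoprime m n →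
    ((kubertTateFive m n).baseChange ℚ).HasAdditiveReductionAt ((Rat.HeightOneSpectrum.primesEquiv (R := ℤ)).symm ⟨5, by norm_num⟩) →
    (((25 : ℤ) ∣ m - 18 * n →
        ((kubertTateFive m n).baseChange ℚ).localRootNumberAt ((Rat.HeightOneSpectrum.primesEquiv (R := ℤ)).symm ⟨5, by norm_num⟩) = -1) ∧
      (¬ (25 : ℤ) ∣ m - 18 * n →
        ((kubertTateFive m n).baseChange ℚ).localRootNumberAt ((Rat.HeightOneSpectrum.primesEquiv (R := ℤ)).symm ⟨5, by norm_num⟩) = 1))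

/-- E-es-241 (GEOMETRIC STEP of E-es-239).  An elliptic curve over `ℚ` with a rational point of order `5` whose `5`-torsion is fixed
pointwise by `Gal(ℚ̄/ℚ(μ₅))` is `ℚ`-isomorphic to a fibre of the Vélu family `veluFive b = E_b/⟨(0,0)⟩`.
Why it might fail: only through a mis-typing — mathematically it is Maschke + `W ≅ (W/μ₅)/⟨t̄⟩` + Tate normal form; the tree proof
needs the quotient curve by the `μ₅`-line and the uniqueness of a quotient with given kernel.
[cite: SilvermanAEC2009, III.4.12] [cite: Knapp1993, V.5 (5.31)] [cite: Velu1971] -/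
@[conjecture] def SplitFiveTorsionIsVeluQuotient : Prop :=
  ∀ (W : WeierstrassCurve ℚ) [W.IsElliptic], (∃ t : W.toAffine.Point, addOrderOf t = 5) →
    (∀ σ : Field.absoluteGaloisGroup ℚ, (∀ ζ : AlgebraicClosure ℚ, ζ ^ 5 = 1 → σ • ζ = ζ) →
      ∀ T : W.geomTorsion 5, σ • T = T) →
    ∃ (b : ℚ) (C : VariableChange ℚ), C • W = veluFive b

/-- E-es-242 (KUMMER STEP of E-es-239).  If the Vélu quotient `veluFive b = E_b/⟨(0,0)⟩` (elliptic) has a rational point of order `5`,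
then `b` is a fifth power in `ℚ`: the Kummer class `δ(T) = b⁻¹·ℚˣ⁵` of the dual `5`-isogeny must vanish.
Why it might fail: only through a mis-typing — it is the injectivity of the Kummer map `E_b(ℚ)/ψE'(ℚ) ↪ ℚˣ/ℚˣ⁵` at `T`;
cheapest falsifier: a rational `b ∉ ℚˣ⁵` of small height with `5 ∣ #veluFive(b)(ℚ)_tors` (none for `H(b) ≤ 50`, es g43 Kummer-split check).
[cite: SilvermanAEC2009, VIII.2, X.4.9] [cite: Fisher2001FiveSevenDescent, §1] -/
@[conjecture] def VeluFiveRationalFiveTorsion : Prop :=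
  ∀ (b : ℚ) [(veluFive b).IsElliptic], (∃ P : (veluFive b).toAffine.Point, addOrderOf P = 5) → ∃ s : ℚ, b = s ^ 5

/-- EDGE (PROVED): the geometric step and the Kummer step give the moduli row E-es-239 — the rational point of order `5` is transported to
`veluFive b` along the change of variables (`VariableChange.pointEquiv`, `Affine.Point.congrEquiv` preserve the order). [portfolio synthesis] -/
theorem splitFiveTorsionModuli_of (h₁ : SplitFiveTorsionIsVeluQuotient) (h₂ : VeluFiveRationalFiveTorsion) :
    SplitFiveTorsionModuli := by
  intro W _ ht hsplit
  obtain ⟨b, C, hC⟩ := h₁ W ht hsplit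
  haveI : (veluFive b).IsElliptic := hC ▸ inferInstance
  obtain ⟨t, ht5⟩ := ht
  have hP : ∃ P : (veluFive b).toAffine.Point, addOrderOf P = 5 :=
    ⟨Affine.Point.congrEquiv hC (VariableChange.pointEquiv W C t), by
      rw [AddEquiv.addOrderOf_eq, AddEquiv.addOrderOf_eq, ht5]⟩
  obtain ⟨s, hs⟩ := h₂ b hP
  exact ⟨s, C, by rw [hC, hs]⟩

/-- COMPOSITE EDGE (PROVED): E-es-241 ∧ E-es-242 ⟹ L5 (`SplitFiveTorsionRootNumberLaw`, E-es-235), through the landed theorem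
`ShimuraFive.veluFiveFamilyRootNumberLaw_holds` (E-es-238). [portfolio synthesis] -/
theorem splitFiveTorsionRootNumberLaw_of_split (h₁ : SplitFiveTorsionIsVeluQuotient) (h₂ : VeluFiveRationalFiveTorsion) :
    SplitFiveTorsionRootNumberLaw :=
  Summit.BirchSwinnertonDyer.BirchSwinnertonDyer.Theorems.ManinLocalTwoThree.ShimuraFive.splitFiveTorsionRootNumberLaw_of_splitFiveTorsionModuli
    (splitFiveTorsionModuli_of h₁ h₂)

/- The composite edge to `ShimuraFiveNoTwentyFive` (E-es-227's Shimura-side input, displayed modulo Carayol and `λ_p = w_p`) is the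
one-liner `EsG43.shimuraFiveNoTwentyFive_of_family ShimuraFive.veluFiveFamilyRootNumberLaw_holds (splitFiveTorsionModuli_of h₁ h₂) hC hF1`;
it is not restated here (its two named-fact hypotheses are displayed, not registered). -/

end Summit.BirchSwinnertonDyer.Rank1Residual.ManinAdditive.EsG44
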